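import Summits.CriticalPhenomena.PercolationContinuityZ3.Theorems.PercAnnulusCrossingIICChemicalDistanceDeterministic
import HarnessLib

/-!
# The chemical exponents of Kesten's IIC are deterministic constants in `[1, d]` (lane RSW3, p1 gen 14)

builds on p205010 (kernel theorem, internal audit signed; external expert review pending) — used through `θ(p_c) = 0`
(`CSH.percolationContinuity_allDimensions`) and gen 14's a.s. volume envelope in the `criticalProbI` statements; the `ℤ²` statements are unconditional.

Seat `prim-rsw3-p1` (gen 14); memo `run/shared/lean/prim/rsw3/P1-QM.md` §27.  Helper file for the crux `stmt-CriticalPhenomena-4575`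
chain; no definitions, no sorries.

With `D_n = min {dist_ω(0, v) : v ∉ Λ(n)}` the chemical distance of the IIC from its root to `Λ(n)ᶜ` (`…IICChemicalDistanceDeterministic`):

* `iicMeasure_ae_eventually_chemical_le_rpow`, `…_Z2` — at `p_c(ℤ^d)` under (A2)□ (`2 ≤ s ≤ L`): `D_n ≤ n^δ · n^d π_{p_c}(n)` eventually a.s.
  for every `δ > 0` (`D_n ≤ V_n` and gen 14's a.s. volume envelope);
* `iicMeasure_exists_ae_liminf_chemical_linear_eq_const_ge_one` — `liminf_n D_n/(n+1) = χ⁻` a.s. with `1 ≤ χ⁻ ≤ ∞`;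
* `log_natCast_add_le`, `monotone_log_natCast`, `tendsto_log_add_one_div_log_add_two` — bookkeeping;
* **`iicMeasure_exists_ae_chemical_exponents_eq_const`** (`θ(p) = 0`, (A2)□, `2 ≤ s`) — **THE CHEMICAL EXPONENTS
  `α⁺ = limsup_n log D_n / log n` and `α⁻ = liminf_n log D_n / log n` OF KESTEN'S IIC ARE `ν`-A.S. CONSTANT** (normalisation `log(n+2)`);
  `iicMeasure_exists_ae_liminf_chemical_exponent_eq_const_ge_one` — `α⁻ ≥ 1`; `iicMeasure_exists_ae_limsup_chemical_exponent_eq_const_le` —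
  at `p_c(ℤ^d)` under (A2)□ (`2 ≤ s ≤ L`): `α⁺ ≤ d`;
* **`iicMeasure_chemical_exponents_criticalProbI`** — at `p_c(ℤ^d)`, `d ≥ 2`, under (A2)□ at aspect `(s,L)`, `2 ≤ s ≤ L`: there are constants
  `1 ≤ α⁻ ≤ α⁺ ≤ d` with `liminf_n log D_n/log(n+2) = α⁻` and `limsup_n log D_n/log(n+2) = α⁺` `ν`-a.s.; **`iicMeasure_chemical_exponents_Z2`** —
  the same for Kesten's planar IIC with `1 ≤ α⁻ ≤ α⁺ ≤ 2`, unconditionally.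

References: H. Kesten, PTRF 73 (1986); G. Kozma, A. Nachmias, The Alexander–Orbach conjecture holds in high dimensions, Invent. Math. 178 (2009)
(chemical exponents of the IIC, high `d`); H.-O. Georgii (2011), Prop. 7.9.
-/

noncomputable section

namespace Summit.CriticalPhenomena.PercolationContinuityZ3.Theorems.Crossing

open MeasureTheory Filter Topology Literature.Probability.Percolation Literature.Probability.LatticeModels
open Literature.Probability.Percolation.DCT16 Literature.Probability.Percolation.DKT20
open Summit.CriticalPhenomena.PercolationContinuityZ3.Theorems.SurfaceTension
open scoped Literature.Probability.Percolation ENNReal symmDiff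

variable {d : ℕ}

/-! ## Exponent bounds from `n + 1 ≤ D_n ≤ V_n` -/

open Classical in
/-- **THE CHEMICAL EXPONENT OF THE IIC IS AT MOST THE VOLUME EXPONENT** (`p_c(ℤ^d)`, `d ≥ 2`, (A2)□ at aspect `(s,L)`, `2 ≤ s ≤ L`): for every
`δ > 0`, `ν`-a.s. eventually `D_n ≤ n^δ · n^d π_{p_c}(n)` (gen 14's a.s. volume envelope `iicMeasure_ae_eventually_volume_le_rpow` and `D_n ≤ V_n`).
[cite: Kesten1986, Thm. (8)] [cite: BasuSapozhnikov2017ECP, Thm. 1.1] -/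
theorem iicMeasure_ae_eventually_chemical_le_rpow (hd : 2 ≤ d) {s L : ℕ} (hs : 2 ≤ s) (hsL : s ≤ L) {ϰ : ℝ} (hϰ : 0 < ϰ)
    (hA2 : SetToSetQuasiMultAspectAt d (criticalProbI d) s L ϰ)
    {ν : Measure (BondConfig (Site d))} [IsProbabilityMeasure ν]
    (hν : ∀ (F : Finset (Sym2 (Site d))) (E : Set (BondConfig (Site d))), MeasurableSet E → DeterminedBy E ↑F →
      Tendsto (fun n : ℕ => (bondPercolation (zdGraph d) (criticalProbI d)).real (E ∩ siteToBoundary d n) /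
        oneArmProb d (criticalProbI d) n) atTop (𝓝 (ν.real E)))
    {δ : ℝ} (hδ : 0 < δ) :
    ∀ᵐ ω ∂ν, ∀ᶠ n : ℕ in atTop,
      (((⨅ v : {v : Site d // v ∉ box d n}, (openGraph ω).edist (0 : Site d) v.1).toNat : ℕ) : ℝ) ≤
        (n : ℝ) ^ δ * ((n : ℝ) ^ d * oneArmProb d (criticalProbI d) n) := by
  have hd1 : 1 ≤ d := by omega
  have hpc : 0 < ((criticalProbI d : unitInterval) : ℝ) := by rw [coe_criticalProbI]; exact criticalProb_zd_pos d hd1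
  filter_upwards [iicMeasure_ae_eventually_volume_le_rpow hd hs hsL hϰ hA2 hν hδ,
    iicMeasure_ae_chemical_le_volume hd1 (criticalProbI d) hpc hν] with ω hω hω'
  refine hω.mono fun n hn => le_trans ?_ hn
  exact_mod_cast (hω' n).2

open Classical in
/-- **Kesten's planar IIC, unconditionally**: for every `δ > 0`, `ν`-a.s. eventually `n + 1 ≤ D_n ≤ n^δ · n² π_{p_c}(n)` ((A2)□ at aspect
`(9,77)` by RSW). [cite: Kesten1986, Thm. (8)] -/
theorem iicMeasure_ae_eventually_chemical_le_rpow_Z2 {ν : Measure (BondConfig (Site 2))} [IsProbabilityMeasure ν]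
    (hν : ∀ (F : Finset (Sym2 (Site 2))) (E : Set (BondConfig (Site 2))), MeasurableSet E → DeterminedBy E ↑F →
      Tendsto (fun n : ℕ => (bondPercolation (zdGraph 2) (criticalProbI 2)).real (E ∩ siteToBoundary 2 n) /
        oneArmProb 2 (criticalProbI 2) n) atTop (𝓝 (ν.real E)))
    {δ : ℝ} (hδ : 0 < δ) :
    ∀ᵐ ω ∂ν, ∀ᶠ n : ℕ in atTop, (n : ℝ) + 1 ≤ (((⨅ v : {v : Site 2 // v ∉ box 2 n}, (openGraph ω).edist (0 : Site 2) v.1).toNat : ℕ) : ℝ) ∧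
      (((⨅ v : {v : Site 2 // v ∉ box 2 n}, (openGraph ω).edist (0 : Site 2) v.1).toNat : ℕ) : ℝ) ≤
        (n : ℝ) ^ δ * ((n : ℝ) ^ 2 * oneArmProb 2 (criticalProbI 2) n) := by
  obtain ⟨ϰ, hϰ, hA2⟩ := exists_setToSetQuasiMultAspectAt_two_of_criticalProbI_le
  have hpc : 0 < ((criticalProbI 2 : unitInterval) : ℝ) := by rw [coe_criticalProbI]; exact criticalProb_zd_pos 2 (by norm_num)
  filter_upwards [iicMeasure_ae_eventually_chemical_le_rpow (d := 2) le_rfl (by norm_num) (by norm_num) hϰ (hA2 _ le_rfl) hν hδ,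
    iicMeasure_ae_chemical_le_volume (d := 2) (by norm_num) (criticalProbI 2) hpc hν] with ω hω hω'
  refine hω.mono fun n hn => ⟨?_, hn⟩
  exact_mod_cast (hω' n).1

/-- **At the linear scale the lower chemical growth rate is a constant `χ⁻ ≥ 1`**: `liminf_n D_n/(n+1) = χ⁻` `ν`-a.s. with `1 ≤ χ⁻ ≤ ∞`
(`θ(p) = 0`, (A2)□, `2 ≤ s`). [cite: Kesten1986, Thm. (3)] [cite: Georgii2011, Prop. 7.9] -/
theorem iicMeasure_exists_ae_liminf_chemical_linear_eq_const_ge_one (hd : 1 ≤ d) (p : unitInterval) (hp : 0 < (p : ℝ))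
    (hθ : theta (zdGraph d) 0 p = 0) {s L : ℕ} (hs : 2 ≤ s) {ϰ : ℝ} (hϰ : 0 < ϰ) (hA2 : SetToSetQuasiMultAspectAt d p s L ϰ)
    {ν : Measure (BondConfig (Site d))} [IsProbabilityMeasure ν]
    (hν : ∀ (F : Finset (Sym2 (Site d))) (E : Set (BondConfig (Site d))), MeasurableSet E → DeterminedBy E ↑F →
      Tendsto (fun n : ℕ => (bondPercolation (zdGraph d) p).real (E ∩ siteToBoundary d n) / oneArmProb d p n)
        atTop (𝓝 (ν.real E))) :
    ∃ c : ℝ≥0∞, 1 ≤ c ∧ ∀ᵐ ω ∂ν, liminf (fun n => ENNReal.ofReal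
        ((((⨅ v : {v : Site d // v ∉ box d n}, (openGraph ω).edist (0 : Site d) v.1).toNat : ℕ) : ℝ) / ((n : ℝ) + 1))) atTop = c := by
  have hσ : ∀ n : ℕ, 0 < (n : ℝ) + 1 := fun n => by positivity
  obtain ⟨-, c, hc⟩ := iicMeasure_exists_ae_chemical_rates_eq_const hd p hp hθ hs hϰ hA2 hν (fun n => (n : ℝ) + 1) hσ
    (tendsto_atTop_add_const_right _ 1 tendsto_natCast_atTop_atTop)
  refine ⟨c, ?_, hc⟩
  obtain ⟨ω, hωc, hω⟩ := (hc.and (iicMeasure_ae_succ_le_chemical_ne_top hd p hp hν)).exists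
  rw [← hωc]
  refine le_liminf_of_le (by isBoundedDefault) (Filter.Eventually.of_forall fun n => ?_)
  obtain ⟨hle, hne⟩ := hω n
  have h1 : n + 1 ≤ (⨅ v : {v : Site d // v ∉ box d n}, (openGraph ω).edist (0 : Site d) v.1).toNat := by
    have h := ENat.toNat_le_toNat hle hne
    rwa [show (((n + 1 : ℕ) : ℕ∞)).toNat = n + 1 from ENat.toNat_coe _] at h
  have h2 : (1 : ℝ) ≤ (((⨅ v : {v : Site d // v ∉ box d n}, (openGraph ω).edist (0 : Site d) v.1).toNat : ℕ) : ℝ) / ((n : ℝ) + 1) := by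
    rw [le_div_iff₀ (hσ n), one_mul]
    exact_mod_cast h1
  calc (1 : ℝ≥0∞) = ENNReal.ofReal 1 := ENNReal.ofReal_one.symm
    _ ≤ _ := ENNReal.ofReal_le_ofReal h2


/-! ## Bookkeeping for `log` -/

/-- `log(a + B) ≤ log a + B` for naturals (`log 0 = 0`). [folklore] -/
theorem log_natCast_add_le (a B : ℕ) : Real.log ((a : ℝ) + B) ≤ Real.log (a : ℝ) + B := by
  rcases Nat.eq_zero_or_pos a with rfl | ha
  · simp only [Nat.cast_zero, Real.log_zero, zero_add]
    exact Real.log_le_self (Nat.cast_nonneg B)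
  · have ha' : (0 : ℝ) < a := by exact_mod_cast ha
    have hab : (0 : ℝ) < (a : ℝ) + B := by positivity
    have h1 : Real.log ((a : ℝ) + B) - Real.log (a : ℝ) = Real.log (((a : ℝ) + B) / a) := (Real.log_div hab.ne' ha'.ne').symm
    have h2 : Real.log (((a : ℝ) + B) / a) ≤ ((a : ℝ) + B) / a - 1 := Real.log_le_sub_one_of_pos (div_pos hab ha')
    have h3 : ((a : ℝ) + B) / a - 1 = (B : ℝ) / a := by field_simp; ring
    have h4 : (B : ℝ) / a ≤ B := div_le_self (Nat.cast_nonneg B) (by exact_mod_cast ha)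
    linarith

/-- `a ↦ log a` is monotone on `ℕ` (`log 0 = 0 ≤ log b`). [folklore] -/
theorem monotone_log_natCast : Monotone fun a : ℕ => Real.log (a : ℝ) := by
  intro a b hab
  rcases Nat.eq_zero_or_pos a with rfl | ha
  · simp only [Nat.cast_zero, Real.log_zero]; exact Real.log_natCast_nonneg b
  · exact Real.log_le_log (by exact_mod_cast ha) (by exact_mod_cast hab)

/-- `log(n+1)/log(n+2) → 1`. [folklore] -/
theorem tendsto_log_add_one_div_log_add_two :
    Tendsto (fun n : ℕ => Real.log ((n : ℝ) + 1) / Real.log ((n : ℝ) + 2)) atTop (𝓝 1) := by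
  have hlog : Tendsto (fun n : ℕ => Real.log ((n : ℝ) + 2)) atTop atTop :=
    Real.tendsto_log_atTop.comp (tendsto_atTop_add_const_right _ _ tendsto_natCast_atTop_atTop)
  have hinv : Tendsto (fun n : ℕ => 1 - (Real.log ((n : ℝ) + 2))⁻¹) atTop (𝓝 1) := by
    have h := (tendsto_const_nhds (x := (1 : ℝ))).sub hlog.inv_tendsto_atTop
    simpa using h
  have h2 : ∀ n : ℕ, 0 < Real.log ((n : ℝ) + 2) := fun n =>
    Real.log_pos (by linarith [(Nat.cast_nonneg n : (0 : ℝ) ≤ n)])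
  refine tendsto_of_tendsto_of_tendsto_of_le_of_le' hinv tendsto_const_nhds
    (Filter.Eventually.of_forall fun n => ?_) (Filter.Eventually.of_forall fun n => ?_)
  · -- `1 - 1/log(n+2) ≤ log(n+1)/log(n+2)` since `log(n+2) - log(n+1) ≤ 1`
    have hdiff : Real.log ((n : ℝ) + 2) - Real.log ((n : ℝ) + 1) ≤ 1 := by
      rw [← Real.log_div (by positivity) (by positivity)]
      refine (Real.log_le_sub_one_of_pos (by positivity)).trans ?_
      rw [div_sub_one (by positivity : ((n : ℝ) + 1) ≠ 0), div_le_one (by positivity)]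
      linarith
    rw [show Real.log ((n : ℝ) + 1) / Real.log ((n : ℝ) + 2) = 1 - (Real.log ((n : ℝ) + 2) - Real.log ((n : ℝ) + 1)) *
      (Real.log ((n : ℝ) + 2))⁻¹ by field_simp [(h2 n).ne']; ring]
    have hinv0 : 0 ≤ (Real.log ((n : ℝ) + 2))⁻¹ := inv_nonneg.2 (h2 n).le
    nlinarith
  · rw [div_le_one (h2 n)]
    exact Real.log_le_log (by positivity) (by linarith)

/-! ## The chemical exponents -/

/-- **THE CHEMICAL EXPONENTS OF KESTEN'S IIC ARE DETERMINISTIC** (`θ(p) = 0`, (A2)□ at aspect `(s,L)`, `2 ≤ s`, `0 < p`, `d ≥ 1`; `ν` any IIC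
measure): there are constants `α⁺, α⁻ ∈ [0,∞]` with `limsup_n log D_n / log(n+2) = α⁺` and `liminf_n log D_n / log(n+2) = α⁻` `ν`-a.s.
(`iicMeasure_exists_ae_chemical_comp_rates_eq_const` with `φ = log`, admissible by `log(a+B) ≤ log a + B`).
[cite: Kesten1986, Thm. (3)] [cite: Georgii2011, Prop. 7.9] -/
theorem iicMeasure_exists_ae_chemical_exponents_eq_const (hd : 1 ≤ d) (p : unitInterval) (hp : 0 < (p : ℝ))
    (hθ : theta (zdGraph d) 0 p = 0) {s L : ℕ} (hs : 2 ≤ s) {ϰ : ℝ} (hϰ : 0 < ϰ) (hA2 : SetToSetQuasiMultAspectAt d p s L ϰ)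
    {ν : Measure (BondConfig (Site d))} [IsProbabilityMeasure ν]
    (hν : ∀ (F : Finset (Sym2 (Site d))) (E : Set (BondConfig (Site d))), MeasurableSet E → DeterminedBy E ↑F →
      Tendsto (fun n : ℕ => (bondPercolation (zdGraph d) p).real (E ∩ siteToBoundary d n) / oneArmProb d p n)
        atTop (𝓝 (ν.real E))) :
    (∃ c : ℝ≥0∞, ∀ᵐ ω ∂ν, limsup (fun n => ENNReal.ofReal
        (Real.log (((⨅ v : {v : Site d // v ∉ box d n}, (openGraph ω).edist (0 : Site d) v.1).toNat : ℕ) : ℝ) /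
          Real.log ((n : ℝ) + 2))) atTop = c) ∧
    (∃ c : ℝ≥0∞, ∀ᵐ ω ∂ν, liminf (fun n => ENNReal.ofReal
        (Real.log (((⨅ v : {v : Site d // v ∉ box d n}, (openGraph ω).edist (0 : Site d) v.1).toNat : ℕ) : ℝ) /
          Real.log ((n : ℝ) + 2))) atTop = c) :=
  iicMeasure_exists_ae_chemical_comp_rates_eq_const hd p hp hθ hs hϰ hA2 hν (fun a => Real.log (a : ℝ)) Real.log_natCast_nonneg
    monotone_log_natCast (fun B => ⟨(B : ℝ), fun a => by simp only [Nat.cast_add]; exact log_natCast_add_le a B⟩)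
    (fun n => Real.log ((n : ℝ) + 2)) (fun n => Real.log_pos (by linarith [(Nat.cast_nonneg n : (0 : ℝ) ≤ n)]))
    (Real.tendsto_log_atTop.comp (tendsto_atTop_add_const_right _ _ tendsto_natCast_atTop_atTop))

/-- **The lower chemical exponent is at least `1`**: `liminf_n log D_n / log(n+2) = α⁻` a.s. with `1 ≤ α⁻` (`D_n ≥ n + 1`).
[cite: Kesten1986, Thm. (3)] -/
theorem iicMeasure_exists_ae_liminf_chemical_exponent_eq_const_ge_one (hd : 1 ≤ d) (p : unitInterval) (hp : 0 < (p : ℝ))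
    (hθ : theta (zdGraph d) 0 p = 0) {s L : ℕ} (hs : 2 ≤ s) {ϰ : ℝ} (hϰ : 0 < ϰ) (hA2 : SetToSetQuasiMultAspectAt d p s L ϰ)
    {ν : Measure (BondConfig (Site d))} [IsProbabilityMeasure ν]
    (hν : ∀ (F : Finset (Sym2 (Site d))) (E : Set (BondConfig (Site d))), MeasurableSet E → DeterminedBy E ↑F →
      Tendsto (fun n : ℕ => (bondPercolation (zdGraph d) p).real (E ∩ siteToBoundary d n) / oneArmProb d p n)
        atTop (𝓝 (ν.real E))) :
    ∃ c : ℝ≥0∞, 1 ≤ c ∧ ∀ᵐ ω ∂ν, liminf (fun n => ENNReal.ofReal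
        (Real.log (((⨅ v : {v : Site d // v ∉ box d n}, (openGraph ω).edist (0 : Site d) v.1).toNat : ℕ) : ℝ) /
          Real.log ((n : ℝ) + 2))) atTop = c := by
  obtain ⟨-, c, hc⟩ := iicMeasure_exists_ae_chemical_exponents_eq_const hd p hp hθ hs hϰ hA2 hν
  refine ⟨c, ?_, hc⟩
  obtain ⟨ω, hωc, hω⟩ := (hc.and (iicMeasure_ae_chemical_le_volume hd p hp hν)).exists
  rw [← hωc]
  have hg : Tendsto (fun n : ℕ => ENNReal.ofReal (Real.log ((n : ℝ) + 1) / Real.log ((n : ℝ) + 2))) atTop (𝓝 1) := by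
    rw [← ENNReal.ofReal_one]
    exact ENNReal.tendsto_ofReal tendsto_log_add_one_div_log_add_two
  rw [← hg.liminf_eq]
  refine liminf_le_liminf (Filter.Eventually.of_forall fun n => ?_)
  have h2 : 0 < Real.log ((n : ℝ) + 2) := Real.log_pos (by linarith [(Nat.cast_nonneg n : (0 : ℝ) ≤ n)])
  refine ENNReal.ofReal_le_ofReal (div_le_div_of_nonneg_right ?_ h2.le)
  have h1 : (n : ℝ) + 1 ≤ (((⨅ v : {v : Site d // v ∉ box d n}, (openGraph ω).edist (0 : Site d) v.1).toNat : ℕ) : ℝ) := by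
    exact_mod_cast (hω n).1
  exact Real.log_le_log (by positivity) h1

/-- **The upper chemical exponent is at most `d`** (`p_c(ℤ^d)`, `d ≥ 2`, (A2)□ at aspect `(s,L)`, `2 ≤ s ≤ L`): `limsup_n log D_n / log(n+2) = α⁺`
a.s. with `α⁺ ≤ d` (`D_n ≤ n^δ · n^d π_{p_c}(n) ≤ n^{d+δ}` eventually a.s., every `δ > 0`). [cite: Kesten1986, Thm. (8)] -/
theorem iicMeasure_exists_ae_limsup_chemical_exponent_eq_const_le (hd : 2 ≤ d) {s L : ℕ} (hs : 2 ≤ s) (hsL : s ≤ L) {ϰ : ℝ} (hϰ : 0 < ϰ)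
    (hA2 : SetToSetQuasiMultAspectAt d (criticalProbI d) s L ϰ)
    {ν : Measure (BondConfig (Site d))} [IsProbabilityMeasure ν]
    (hν : ∀ (F : Finset (Sym2 (Site d))) (E : Set (BondConfig (Site d))), MeasurableSet E → DeterminedBy E ↑F →
      Tendsto (fun n : ℕ => (bondPercolation (zdGraph d) (criticalProbI d)).real (E ∩ siteToBoundary d n) /
        oneArmProb d (criticalProbI d) n) atTop (𝓝 (ν.real E))) :
    ∃ c : ℝ≥0∞, c ≤ d ∧ ∀ᵐ ω ∂ν, limsup (fun n => ENNReal.ofReal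
        (Real.log (((⨅ v : {v : Site d // v ∉ box d n}, (openGraph ω).edist (0 : Site d) v.1).toNat : ℕ) : ℝ) /
          Real.log ((n : ℝ) + 2))) atTop = c := by
  have hd1 : 1 ≤ d := by omega
  have hpc : 0 < ((criticalProbI d : unitInterval) : ℝ) := by rw [coe_criticalProbI]; exact criticalProb_zd_pos d hd1
  obtain ⟨⟨c, hc⟩, -⟩ := iicMeasure_exists_ae_chemical_exponents_eq_const hd1 (criticalProbI d) hpc
    (CSH.percolationContinuity_allDimensions d hd) hs hϰ hA2 hν
  refine ⟨c, ENNReal.le_of_forall_pos_le_add fun δ hδ _ => ?_, hc⟩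
  have hδ' : (0 : ℝ) < δ := by exact_mod_cast hδ
  obtain ⟨ω, hωc, hω⟩ := (hc.and (iicMeasure_ae_eventually_chemical_le_rpow hd hs hsL hϰ hA2 hν hδ')).exists
  rw [← hωc]
  refine limsup_le_of_le (by isBoundedDefault) ?_
  filter_upwards [hω, Filter.eventually_ge_atTop 1] with n hn hn1
  have h2 : 0 < Real.log ((n : ℝ) + 2) := Real.log_pos (by linarith [(Nat.cast_nonneg n : (0 : ℝ) ≤ n)])
  have hn0 : (0 : ℝ) < n := by exact_mod_cast hn1
  have hπ1 : oneArmProb d (criticalProbI d) n ≤ 1 := measureReal_le_one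
  have hpow : (n : ℝ) ^ (δ : ℝ) * ((n : ℝ) ^ d * oneArmProb d (criticalProbI d) n) ≤ (n : ℝ) ^ (δ : ℝ) * (n : ℝ) ^ d := by
    have h0 : 0 ≤ (n : ℝ) ^ (δ : ℝ) * (n : ℝ) ^ d := by positivity
    calc (n : ℝ) ^ (δ : ℝ) * ((n : ℝ) ^ d * oneArmProb d (criticalProbI d) n)
        = ((n : ℝ) ^ (δ : ℝ) * (n : ℝ) ^ d) * oneArmProb d (criticalProbI d) n := by ring
      _ ≤ ((n : ℝ) ^ (δ : ℝ) * (n : ℝ) ^ d) * 1 := mul_le_mul_of_nonneg_left hπ1 h0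
      _ = (n : ℝ) ^ (δ : ℝ) * (n : ℝ) ^ d := mul_one _
  have hbound : Real.log ((((⨅ v : {v : Site d // v ∉ box d n}, (openGraph ω).edist (0 : Site d) v.1).toNat : ℕ) : ℝ)) ≤
      ((d : ℝ) + δ) * Real.log ((n : ℝ) + 2) := by
    rcases Nat.eq_zero_or_pos ((⨅ v : {v : Site d // v ∉ box d n}, (openGraph ω).edist (0 : Site d) v.1).toNat) with h0 | hpos
    · rw [h0, Nat.cast_zero, Real.log_zero]; positivity
    · calc Real.log ((((⨅ v : {v : Site d // v ∉ box d n}, (openGraph ω).edist (0 : Site d) v.1).toNat : ℕ) : ℝ))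
          ≤ Real.log ((n : ℝ) ^ (δ : ℝ) * (n : ℝ) ^ d) := Real.log_le_log (by exact_mod_cast hpos) (hn.trans hpow)
        _ = (δ : ℝ) * Real.log n + (d : ℝ) * Real.log n := by
            rw [Real.log_mul (by positivity) (by positivity), Real.log_rpow hn0, Real.log_pow]
        _ = ((d : ℝ) + δ) * Real.log n := by ring
        _ ≤ ((d : ℝ) + δ) * Real.log ((n : ℝ) + 2) :=
            mul_le_mul_of_nonneg_left (Real.log_le_log hn0 (by linarith)) (by positivity)
  calc ENNReal.ofReal (Real.log ((((⨅ v : {v : Site d // v ∉ box d n}, (openGraph ω).edist (0 : Site d) v.1).toNat : ℕ) : ℝ)) /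
        Real.log ((n : ℝ) + 2)) ≤ ENNReal.ofReal ((d : ℝ) + δ) := ENNReal.ofReal_le_ofReal (by rwa [div_le_iff₀ h2])
    _ = (d : ℝ≥0∞) + δ := by rw [ENNReal.ofReal_add (by positivity) (by positivity), ENNReal.ofReal_natCast, ENNReal.ofReal_coe_nnreal]

/-- **THE CHEMICAL EXPONENTS OF THE IIC AT `p_c(ℤ^d)`: DETERMINISTIC CONSTANTS `1 ≤ α⁻ ≤ α⁺ ≤ d`** (`d ≥ 2`, (A2)□ at aspect `(s,L)`, `2 ≤ s ≤ L`;
`ν` any IIC measure at `p_c`): `liminf_n log D_n / log(n+2) = α⁻` and `limsup_n log D_n / log(n+2) = α⁺` `ν`-a.s.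
[cite: Kesten1986, Thm. (3), (8)] [cite: BasuSapozhnikov2017ECP, Thm. 1.1] [cite: Georgii2011, Prop. 7.9] -/
theorem iicMeasure_chemical_exponents_criticalProbI (hd : 2 ≤ d) {s L : ℕ} (hs : 2 ≤ s) (hsL : s ≤ L) {ϰ : ℝ} (hϰ : 0 < ϰ)
    (hA2 : SetToSetQuasiMultAspectAt d (criticalProbI d) s L ϰ)
    {ν : Measure (BondConfig (Site d))} [IsProbabilityMeasure ν]
    (hν : ∀ (F : Finset (Sym2 (Site d))) (E : Set (BondConfig (Site d))), MeasurableSet E → DeterminedBy E ↑F →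
      Tendsto (fun n : ℕ => (bondPercolation (zdGraph d) (criticalProbI d)).real (E ∩ siteToBoundary d n) /
        oneArmProb d (criticalProbI d) n) atTop (𝓝 (ν.real E))) :
    ∃ αl αu : ℝ≥0∞, 1 ≤ αl ∧ αl ≤ αu ∧ αu ≤ d ∧ ∀ᵐ ω ∂ν,
      liminf (fun n => ENNReal.ofReal
        (Real.log (((⨅ v : {v : Site d // v ∉ box d n}, (openGraph ω).edist (0 : Site d) v.1).toNat : ℕ) : ℝ) /
          Real.log ((n : ℝ) + 2))) atTop = αl ∧
      limsup (fun n => ENNReal.ofReal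
        (Real.log (((⨅ v : {v : Site d // v ∉ box d n}, (openGraph ω).edist (0 : Site d) v.1).toNat : ℕ) : ℝ) /
          Real.log ((n : ℝ) + 2))) atTop = αu := by
  have hd1 : 1 ≤ d := by omega
  have hpc : 0 < ((criticalProbI d : unitInterval) : ℝ) := by rw [coe_criticalProbI]; exact criticalProb_zd_pos d hd1
  obtain ⟨αl, hl1, hl⟩ := iicMeasure_exists_ae_liminf_chemical_exponent_eq_const_ge_one hd1 (criticalProbI d) hpc
    (CSH.percolationContinuity_allDimensions d hd) hs hϰ hA2 hν
  obtain ⟨αu, hud, hu⟩ := iicMeasure_exists_ae_limsup_chemical_exponent_eq_const_le hd hs hsL hϰ hA2 hν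
  obtain ⟨ω, hωl, hωu⟩ := (hl.and hu).exists
  refine ⟨αl, αu, hl1, ?_, hud, hl.and hu⟩
  rw [← hωl, ← hωu]
  exact liminf_le_limsup

/-- **Kesten's planar IIC, unconditionally: the chemical exponents are deterministic constants `1 ≤ α⁻ ≤ α⁺ ≤ 2`** ((A2)□ at aspect `(9,77)`
by RSW). [cite: Kesten1986, Thm. (3), (8)] [cite: Georgii2011, Prop. 7.9] -/
theorem iicMeasure_chemical_exponents_Z2 {ν : Measure (BondConfig (Site 2))} [IsProbabilityMeasure ν]
    (hν : ∀ (F : Finset (Sym2 (Site 2))) (E : Set (BondConfig (Site 2))), MeasurableSet E → DeterminedBy E ↑F →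
      Tendsto (fun n : ℕ => (bondPercolation (zdGraph 2) (criticalProbI 2)).real (E ∩ siteToBoundary 2 n) /
        oneArmProb 2 (criticalProbI 2) n) atTop (𝓝 (ν.real E))) :
    ∃ αl αu : ℝ≥0∞, 1 ≤ αl ∧ αl ≤ αu ∧ αu ≤ 2 ∧ ∀ᵐ ω ∂ν,
      liminf (fun n => ENNReal.ofReal
        (Real.log (((⨅ v : {v : Site 2 // v ∉ box 2 n}, (openGraph ω).edist (0 : Site 2) v.1).toNat : ℕ) : ℝ) /
          Real.log ((n : ℝ) + 2))) atTop = αl ∧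
      limsup (fun n => ENNReal.ofReal
        (Real.log (((⨅ v : {v : Site 2 // v ∉ box 2 n}, (openGraph ω).edist (0 : Site 2) v.1).toNat : ℕ) : ℝ) /
          Real.log ((n : ℝ) + 2))) atTop = αu := by
  obtain ⟨ϰ, hϰ, hA2⟩ := exists_setToSetQuasiMultAspectAt_two_of_criticalProbI_le
  have h := iicMeasure_chemical_exponents_criticalProbI (d := 2) le_rfl (by norm_num) (by norm_num) hϰ (hA2 _ le_rfl) hν
  simpa using h

end Summit.CriticalPhenomena.PercolationContinuityZ3.Theorems.Crossing

end
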